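import Summits.BirchSwinnertonDyer.BirchSwinnertonDyer.Theorems.ErratumRoadFiveNonSurjCornerKolyJProp44AnyPair
import Summits.BirchSwinnertonDyer.BirchSwinnertonDyer.Theorems.ErratumRoadFiveNonSurjCornerKolyJProp44WalkH47
import Literature.NumberTheory.EllipticCurves.GrossLMS1991.HeegnerEulerSystemCongruenceImageFree
import HarnessLib

/-!
# McCallum Prop. 4.4 «in particular» on the irreducible corner BY NAME of the Literature fact
# `GrossLMS1991.prop37_2_frobeniusCongruence` (Gross 1991 Prop. 3.7 (2) = Nekovář 2007 Prop. 4.13 (ii), image-free) —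
# the corner's (γ) input is now ONE PUBLISHED, TYPED fact (cell `bsd-stepL`, seat `bsd-stepL-corner-p1` g11;
# `--supports stmt-BirchSwinnertonDyer-19947`; memo CORNER-G10 §3 (1), lit g26 STATUS 15:17Z ∕ 15:38Z ∕ 16:00Z)

WHY. Sessions g9–g10 of this seat proved McCallum's Prop. 4.4 «in particular» (`ord c_M(mℓ)_λ = ord c_M(m)_λ`, the
`h47` ∕ `h44c` inputs of the corner stub `stub_kolyJ_max` and of 19109's walk) as KERNEL theorems on the irreducible
cell modulo ONE print input (γ) = Gross Prop. 3.7 (2) in pair form, carried as a hypothesis `hγ` ∕ `hγW`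
(`Prop44.localOrder_kolyvaginClass_mul_eq_of_irr`, `…AnyPair`; `Prop44.exists_data_h47Base_of_congruence_of_irr`,
`…WalkH47`). The cell's literature seat typed (γ) as the image-free named fact
`Literature.NumberTheory.EllipticCurves.GrossLMS1991.prop37_2_frobeniusCongruence` (p534286) with the pair reading
`prop37_2_frobeniusCongruence.reductionCongruence_pair` (p543496) whose conclusion is the body of `hγ` character for
character. This file performs the keying: every `hγ`-conditional theorem of g10 becomes a theorem conditional on the
NAMED fact `(h : GrossLMS1991.prop37_2_frobeniusCongruence)` alone.

THE PRINT EDGE `ℓ ≠ 2`. Nekovář's Prop. 4.13 (ii) is printed for `ℓ𝒪_K ∤ I_0 = (2)`, i.e. `ℓ ≠ 2`; Gross covers `ℓ = 2`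
only in his §2 setting (surjective `p`) — VOID on the corner. A Zhang–Kolyvagin prime `ℓ` of index `≥ 1` has
`p ∣ ℓ + 1`; `ℓ = 2` forces `p ∣ 3`, i.e. `p = 3`. So OFF `p = 3` (in particular on the T4′ corner, `p ∈ {5, 7}`) the
clause is automatic: `ne_two_of_isKolyvaginPrime_of_ne_three`. At `p = 3` (19111, `M = 1`) `ℓ = 2` is a possible
Kolyvagin prime and stays outside print — the theorems below carry `p ≠ 3` and say so.

WHAT IS PROVED (all CONDITIONAL on the named fact; `K : Type`):
* `ne_two_of_isKolyvaginPrime_of_ne_three` — a Zhang–Kolyvagin prime for `p ≠ 3` is odd-and-not-2 (`ℓ ≠ 2`).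
* `congruence_pair_of_frobeniusCongruence` — the `hγ` binder of `…AnyPair` ∕ `…LocalOrder` at a pair `(mℓ, m)` of
  Zhang–Kolyvagin levels, `p ≠ 3`, from `h` (one call of `reductionCongruence_pair` with `Or.inl`).
* `congruenceW_of_frobeniusCongruence` — the `hγW`-shaped supplier keyed on Zhang–Kolyvagin prime factors for `p ≠ 3`.
* `localOrder_kolyvaginClass_mul_eq_of_frobeniusCongruence_of_irr`, `addOrderOf_localization_kolyvaginClass_mul_eq_…`
  (the walk's `h47`, ANY two data), `kolyvaginClass_mul_mem_torsionLocalKer_iff_…` (the swap's `h44c`, ANY two data),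
  `exists_data_h47Base_of_frobeniusCongruence_of_irr` (tam3's based-family `h47`): g10's theorems with `hγ` ∕ `hγW`
  replaced by `h` and `p ≠ 3`.
HONEST FRAMING: conditional on ONE published, typed, unformalised fact (Eichler–Shimura congruence for Heegner points);
nothing about any curve's BSD; no stub closes; T7. References: [cite: GrossLMS1991, Prop. 3.7 (2) (p. 240), §4 (4.1)]
[cite: Nekovar2007, Prop. 4.9, Prop. 4.13 (ii), (4.3)] [cite: McCallumLMS1991, §4 Prop. 4.4 (p. 301)]
[cite: Jetchev2008, Prop. 4.4 (p. 821)] [cite: WZhang2014, Notations (xii)].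
-/

set_option autoImplicit false
set_option linter.dupNamespace false

noncomputable section

open scoped Classical
open WeierstrassCurve Field NumberField IsDedekindDomain Finset
open Literature.NumberTheory.EllipticCurves Literature.NumberTheory.GaloisRepresentations
open Literature.NumberTheory.EllipticCurves.KolyvaginCocycle
open Literature.NumberTheory.EllipticCurves.RingClassField
open Literature.NumberTheory.EllipticCurves.ModularForms
open Literature.NumberTheory.GaloisCohomology
open Summit.BirchSwinnertonDyer.Rank1Residual.X11b
open Summit.BirchSwinnertonDyer.Rank1Residual.JET Summit.BirchSwinnertonDyer.Rank1Residual.X11b.Three.Koly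

namespace Summit.BirchSwinnertonDyer.BirchSwinnertonDyer.Theorems.Prop44

variable {K : Type} [Field K] [NumberField K] {W : WeierstrassCurve ℚ} [W.IsElliptic] [W.IsGloballyMinimal]
  [NeZero (W.conductorNorm ℤ)]

omit [W.IsElliptic] [NeZero (W.conductorNorm ℤ)] in
/-- **A Zhang–Kolyvagin prime for `p ≠ 3` is not `2`.** `M(ℓ) ≥ 1` gives `p ∣ ℓ + 1`; `ℓ = 2` would force the prime `p`
to divide `3`. (At `p = 3`, `ℓ = 2` IS possible: `2 ∤ N`, `2` inert in `K`, `3 ∣ a_2`.) [cite: WZhang2014, Notations (xii)] -/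
theorem ne_two_of_isKolyvaginPrime_of_ne_three {N p ℓ : ℕ} [Fact p.Prime] (hp3 : p ≠ 3)
    (h : Zhang2014.IsKolyvaginPrime N W K p ℓ) : ℓ ≠ 2 := by
  rintro rfl
  have hp : p.Prime := Fact.out
  have h3 : p ∣ 3 := h.dvd.1
  exact hp3 ((Nat.prime_dvd_prime_iff_eq hp Nat.prime_three).mp h3)

/-- **(γ) at a pair of Zhang–Kolyvagin levels `(mℓ, m)`, `p ≠ 3`, BY NAME of Gross Prop. 3.7 (2).** The `hγ` binder of
`localOrder_kolyvaginClass_mul_eq_of_irr` (for every two data `d₁` at `mℓ`, `d₀` at `m`, the place over `ℓ`, the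
`ℓ`-Frobenius and every `γ`): `red(γ·y(mℓ)) = φ₀ • red(γ·(y(m) ↑ K[mℓ]))`, from the Literature fact via
`reductionCongruence_pair` with Nekovář's clause `ℓ ≠ 2` (automatic off `p = 3`), `mℓ` prime to `N_E` and `(ℓ)` inert
(conjuncts of `Zhang2014.IsKolyvaginPrime`). [cite: GrossLMS1991, Prop. 3.7 (2) (p. 240)] [cite: Nekovar2007, Prop. 4.13 (ii)] -/
theorem congruence_pair_of_frobeniusCongruence (h : GrossLMS1991.prop37_2_frobeniusCongruence)
    (hK : IsImaginaryQuadratic K) (hD3 : NumberField.discr K ≠ -3) (hD4 : NumberField.discr K ≠ -4)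
    (hH : SatisfiesHeegnerHypothesis (W.conductorNorm ℤ) K) {p : ℕ} [Fact p.Prime] (hp3 : p ≠ 3)
    {Dt : ModularParametrizationData W (W.conductorNorm ℤ)} {β : ℤ} {ι : K →+* ℂ}
    {m l : ℕ} (hsq : Squarefree (m * l)) (hl : l.Prime)
    (hS : ∀ l' ∈ (m * l).primeFactors, Zhang2014.IsKolyvaginPrime (W.conductorNorm ℤ) W K p l')
    (d₁ : KolyvaginHeegnerData Dt β ι (m * l)) (d₀ : KolyvaginHeegnerData Dt β ι m)
    [Fact l.Prime] (hΔ : ¬ (l : ℤ) ∣ minimalDiscriminantInt W)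
    (φ₀ : absoluteGaloisGroup (ZMod l)) (hφ₀ : ∀ x : AlgebraicClosure (ZMod l), φ₀ • x = x ^ l)
    (hle : ringClassField K ι m ≤ ringClassField K ι (m * l))
    (γ : ringClassField K ι (m * l) ≃ₐ[ℚ] ringClassField K ι (m * l)) :
    geomReduction hΔ ((RatClosure.pointsEquiv (K := K) W).symm
        (d₁.toGeomPoints (pointGalHom W (ringClassField K ι (m * l)) γ d₁.y))) =
      φ₀ • geomReduction hΔ ((RatClosure.pointsEquiv (K := K) W).symm
        (d₁.toGeomPoints (pointGalHom W (ringClassField K ι (m * l)) γ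
          (WeierstrassCurve.Affine.Point.map (W' := W)
            (letI : Algebra K ℂ := ι.toAlgebra; (RingClassField.inclusion ι hle).restrictScalars ℚ)
            d₀.y)))) := by
  have hn0 : m * l ≠ 0 := hsq.ne_zero
  have hKol : Zhang2014.IsKolyvaginPrime (W.conductorNorm ℤ) W K p l :=
    hS l (Nat.mem_primeFactors.mpr ⟨hl, dvd_mul_left l m, hn0⟩)
  have hcop : Nat.Coprime (m * l) (W.conductorNorm ℤ) :=
    (KolyvaginH37Bridge.coprime_of_forall_not_dvd hn0 fun q hq ↦ (hS q hq).2.1).symm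
  exact h.reductionCongruence_pair (N := W.conductorNorm ℤ) rfl hK ⟨hD3, hD4⟩ hH m l hsq hcop
    (Or.inl (ne_two_of_isKolyvaginPrime_of_ne_three hp3 hKol)) hKol.2.2.2.2.1 d₁ d₀ hΔ hφ₀ hle γ

/-- **The `hγW`-shaped (γ) supplier of `exists_data_h47Base_of_congruence_of_irr'` for `p ≠ 3`, BY NAME**: for every
frame and every pair of Zhang–Kolyvagin levels `(mℓ, m)` (prime factors Zhang–Kolyvagin for `p`), the congruence.
[cite: GrossLMS1991, Prop. 3.7 (2) (p. 240)] [cite: Nekovar2007, Prop. 4.13 (ii)] -/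
theorem congruenceW_of_frobeniusCongruence (h : GrossLMS1991.prop37_2_frobeniusCongruence)
    (hK : IsImaginaryQuadratic K) (hD3 : NumberField.discr K ≠ -3) (hD4 : NumberField.discr K ≠ -4)
    (hH : SatisfiesHeegnerHypothesis (W.conductorNorm ℤ) K) {p : ℕ} [Fact p.Prime] (hp3 : p ≠ 3) :
    ∀ (Dt : ModularParametrizationData W (W.conductorNorm ℤ)) (β : ℤ) (ι : K →+* ℂ)
      (m ℓ : ℕ), Squarefree (m * ℓ) → ℓ.Prime → ¬ ℓ ∣ m →
      (∀ q ∈ (m * ℓ).primeFactors, Zhang2014.IsKolyvaginPrime (W.conductorNorm ℤ) W K p q) →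
      ∀ (d' : KolyvaginHeegnerData Dt β ι (m * ℓ)) (d : KolyvaginHeegnerData Dt β ι m)
        [Fact ℓ.Prime] (hΔ : ¬ (ℓ : ℤ) ∣ minimalDiscriminantInt W) (φ₀ : absoluteGaloisGroup (ZMod ℓ)),
        (∀ x : AlgebraicClosure (ZMod ℓ), φ₀ • x = x ^ ℓ) →
        ∀ (hle : ringClassField K ι m ≤ ringClassField K ι (m * ℓ))
          (γ : ringClassField K ι (m * ℓ) ≃ₐ[ℚ] ringClassField K ι (m * ℓ)), γ ∈ ringClassGal ι (m * ℓ) →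
          geomReduction hΔ ((RatClosure.pointsEquiv (K := K) W).symm
              (d'.toGeomPoints (pointGalHom W (ringClassField K ι (m * ℓ)) γ d'.y))) =
            φ₀ • geomReduction hΔ ((RatClosure.pointsEquiv (K := K) W).symm
              (d'.toGeomPoints (pointGalHom W (ringClassField K ι (m * ℓ)) γ
                (WeierstrassCurve.Affine.Point.map (W' := W)
                  (letI : Algebra K ℂ := ι.toAlgebra; (RingClassField.inclusion ι hle).restrictScalars ℚ)
                  d.y)))) :=
  fun _ _ _ _ _ hsq hℓ _ hS d' d _ hΔ φ₀ hφ₀ hle γ _ ↦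
    congruence_pair_of_frobeniusCongruence h hK hD3 hD4 hH hp3 hsq hℓ hS d' d hΔ φ₀ hφ₀ hle γ

/-- **McCallum Prop. 4.4 «in particular» for ANY two data, `E[p]` irreducible, `p ∉ {2, 3}` split in `K`, BY NAME of
Gross Prop. 3.7 (2).** `localOrder_kolyvaginClass_mul_eq_of_irr` with its (γ) binder discharged from the named fact:
at `λ ∋ ℓ`, for every `j`, `p^j c_M(mℓ) ∈ Sel_λ ↔ p^j c_M(mℓ)_λ = 0` and `p^j c_M(mℓ)_λ = 0 ↔ p^j c_M(m)_λ = 0`.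
CONDITIONAL on the fact. [cite: McCallumLMS1991, §4 Prop. 4.4 (p. 301)] [cite: GrossLMS1991, Prop. 3.7 (2), §4 (4.1)]
[cite: WZhang2014, Notations (xii)] -/
theorem localOrder_kolyvaginClass_mul_eq_of_frobeniusCongruence_of_irr
    (h : GrossLMS1991.prop37_2_frobeniusCongruence) (hK : IsImaginaryQuadratic K)
    (hD3 : NumberField.discr K ≠ -3) (hD4 : NumberField.discr K ≠ -4)
    (hH : SatisfiesHeegnerHypothesis (W.conductorNorm ℤ) K) {p : ℕ} [Fact p.Prime] (hp2 : p ≠ 2) (hp3 : p ≠ 3)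
    (hHp : SatisfiesHeegnerHypothesis p K) (hirr : W.HasIrreducibleModPGaloisRep p)
    (Dt : ModularParametrizationData W (W.conductorNorm ℤ)) (β : ℤ) (ι : K →+* ℂ) (M : ℕ) (hM : 1 ≤ M)
    (m l : ℕ) (hsq : Squarefree (m * l)) (hl : l.Prime) (hlm : ¬ l ∣ m)
    (hS : ∀ l' ∈ (m * l).primeFactors, Zhang2014.IsKolyvaginPrime (W.conductorNorm ℤ) W K p l' ∧
      M ≤ Zhang2014.kolyvaginIndex W p l')
    (d : KolyvaginHeegnerData Dt β ι m) (d' : KolyvaginHeegnerData Dt β ι (m * l))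
    (v : HeightOneSpectrum (𝓞 K)) (hv : (l : 𝓞 K) ∈ v.asIdeal) (j : ℕ) :
    (((p ^ j : ℕ) : ℤ) • d'.kolyvaginClass (Fact.out : p.Prime) M ∈
        selmerLocalKer (W.baseChange K) (v.adicCompletion K) ((p ^ M : ℕ) : ℤ) ↔
      ((p ^ j : ℕ) : ℤ) • d'.kolyvaginClass (Fact.out : p.Prime) M ∈
        (W.baseChange K).torsionLocalKer (v.adicCompletion K) ((p ^ M : ℕ) : ℤ)) ∧
    (((p ^ j : ℕ) : ℤ) • d'.kolyvaginClass (Fact.out : p.Prime) M ∈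
        (W.baseChange K).torsionLocalKer (v.adicCompletion K) ((p ^ M : ℕ) : ℤ) ↔
      ((p ^ j : ℕ) : ℤ) • d.kolyvaginClass (Fact.out : p.Prime) M ∈
        (W.baseChange K).torsionLocalKer (v.adicCompletion K) ((p ^ M : ℕ) : ℤ)) :=
  localOrder_kolyvaginClass_mul_eq_of_irr hK hD3 hD4 hH hp2 hHp hirr Dt β ι M hM m l hsq hl hlm hS d d'
    (fun d₁ d₀ _ hΔ φ₀ hφ₀ hle γ _ ↦ congruence_pair_of_frobeniusCongruence h hK hD3 hD4 hH hp3 hsq hl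
      (fun q hq ↦ (hS q hq).1) d₁ d₀ hΔ φ₀ hφ₀ hle γ) v hv j

/-- **The walk's `h47` for ANY two data, BY NAME of Gross Prop. 3.7 (2)** — `addOrderOf (loc_λ c_M(mℓ)) =
addOrderOf (loc_λ c_M(m))`, `E[p]` irreducible, `p ∉ {2, 3}` split in `K`. CONDITIONAL on the fact.
[cite: Jetchev2008, Prop. 4.4 (p. 821)] [cite: McCallumLMS1991, §4 Prop. 4.4 (p. 301)] [cite: GrossLMS1991, Prop. 3.7 (2)] -/
theorem addOrderOf_localization_kolyvaginClass_mul_eq_of_frobeniusCongruence_of_irr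
    (h : GrossLMS1991.prop37_2_frobeniusCongruence) (hK : IsImaginaryQuadratic K)
    (hD3 : NumberField.discr K ≠ -3) (hD4 : NumberField.discr K ≠ -4)
    (hH : SatisfiesHeegnerHypothesis (W.conductorNorm ℤ) K) {p : ℕ} [Fact p.Prime] (hp2 : p ≠ 2) (hp3 : p ≠ 3)
    (hHp : SatisfiesHeegnerHypothesis p K) (hirr : W.HasIrreducibleModPGaloisRep p)
    (Dt : ModularParametrizationData W (W.conductorNorm ℤ)) (β : ℤ) (ι : K →+* ℂ) (M : ℕ) (hM : 1 ≤ M)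
    (m l : ℕ) (hsq : Squarefree (m * l)) (hl : l.Prime) (hlm : ¬ l ∣ m)
    (hS : ∀ l' ∈ (m * l).primeFactors, Zhang2014.IsKolyvaginPrime (W.conductorNorm ℤ) W K p l' ∧
      M ≤ Zhang2014.kolyvaginIndex W p l')
    (d : KolyvaginHeegnerData Dt β ι m) (d' : KolyvaginHeegnerData Dt β ι (m * l))
    (v : HeightOneSpectrum (𝓞 K)) (hv : (l : 𝓞 K) ∈ v.asIdeal) :
    addOrderOf ((galoisCohomology.localization
        ((W.baseChange K).torsionGaloisModule ((p ^ M : ℕ) : ℤ)) (Sum.inr v) 1 :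
          galH1Torsion (W.baseChange K) ((p ^ M : ℕ) : ℤ) →+ _)
        (d'.kolyvaginClass (Fact.out : p.Prime) M)) =
      addOrderOf ((galoisCohomology.localization
        ((W.baseChange K).torsionGaloisModule ((p ^ M : ℕ) : ℤ)) (Sum.inr v) 1 :
          galH1Torsion (W.baseChange K) ((p ^ M : ℕ) : ℤ) →+ _)
        (d.kolyvaginClass (Fact.out : p.Prime) M)) :=
  addOrderOf_localization_kolyvaginClass_mul_eq_of_irr hK hD3 hD4 hH hp2 hHp hirr Dt β ι M hM m l hsq hl hlm hS d d'
    (fun d₁ d₀ _ hΔ φ₀ hφ₀ hle γ _ ↦ congruence_pair_of_frobeniusCongruence h hK hD3 hD4 hH hp3 hsq hl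
      (fun q hq ↦ (hS q hq).1) d₁ d₀ hΔ φ₀ hφ₀ hle γ) v hv

/-- **The swap's `h44c` for ANY two data (`j = 0`), BY NAME of Gross Prop. 3.7 (2)** — `c_M(mℓ)_λ = 0 ↔ c_M(m)_λ = 0`,
`E[p]` irreducible, `p ∉ {2, 3}` split in `K`. CONDITIONAL on the fact.
[cite: McCallumLMS1991, §4 Prop. 4.4 (p. 301)] [cite: GrossLMS1991, Prop. 6.2 (2), Prop. 3.7 (2)] -/
theorem kolyvaginClass_mul_mem_torsionLocalKer_iff_of_frobeniusCongruence_of_irr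
    (h : GrossLMS1991.prop37_2_frobeniusCongruence) (hK : IsImaginaryQuadratic K)
    (hD3 : NumberField.discr K ≠ -3) (hD4 : NumberField.discr K ≠ -4)
    (hH : SatisfiesHeegnerHypothesis (W.conductorNorm ℤ) K) {p : ℕ} [Fact p.Prime] (hp2 : p ≠ 2) (hp3 : p ≠ 3)
    (hHp : SatisfiesHeegnerHypothesis p K) (hirr : W.HasIrreducibleModPGaloisRep p)
    (Dt : ModularParametrizationData W (W.conductorNorm ℤ)) (β : ℤ) (ι : K →+* ℂ) (M : ℕ) (hM : 1 ≤ M)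
    (m l : ℕ) (hsq : Squarefree (m * l)) (hl : l.Prime) (hlm : ¬ l ∣ m)
    (hS : ∀ l' ∈ (m * l).primeFactors, Zhang2014.IsKolyvaginPrime (W.conductorNorm ℤ) W K p l' ∧
      M ≤ Zhang2014.kolyvaginIndex W p l')
    (d : KolyvaginHeegnerData Dt β ι m) (d' : KolyvaginHeegnerData Dt β ι (m * l))
    (v : HeightOneSpectrum (𝓞 K)) (hv : (l : 𝓞 K) ∈ v.asIdeal) :
    d'.kolyvaginClass (Fact.out : p.Prime) M ∈
        (W.baseChange K).torsionLocalKer (v.adicCompletion K) ((p ^ M : ℕ) : ℤ) ↔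
      d.kolyvaginClass (Fact.out : p.Prime) M ∈
        (W.baseChange K).torsionLocalKer (v.adicCompletion K) ((p ^ M : ℕ) : ℤ) :=
  kolyvaginClass_mul_mem_torsionLocalKer_iff_of_irr hK hD3 hD4 hH hp2 hHp hirr Dt β ι M hM m l hsq hl hlm hS d d'
    (fun d₁ d₀ _ hΔ φ₀ hφ₀ hle γ _ ↦ congruence_pair_of_frobeniusCongruence h hK hD3 hD4 hH hp3 hsq hl
      (fun q hq ↦ (hS q hq).1) d₁ d₀ hΔ φ₀ hφ₀ hle γ) v hv

/-- **`h47` of the based ordered walk on the IRREDUCIBLE cell, `p ∉ {2, 3}`, BY NAME of Gross Prop. 3.7 (2).** The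
statement of tam3's `Koly.exists_data_h47Base_of_prop44` ∕ this seat's `exists_data_h47Base_of_congruence_of_irr`
VERBATIM (a data system `D` on the admissible-conductor subtype through the given datum, with equal orders of the
localisations of `c_k(sℓ)` and `c_k(s)` at `λ ∋ ℓ` along every based ordered prime step), with the (γ) supplier `hγW`
replaced by the named fact `h` and `p ≠ 3` (the prime steps are Zhang–Kolyvagin of index `≥ k ≥ 1`, so `ℓ ≠ 2`).
Construction = tam3's (Gross's one system of choices via bsd-jet's `exists_compatible_data_of_grossCM` along
`Walk.exists_basedFamily_of_primeStep`). CONDITIONAL on the fact. [cite: McCallumLMS1991, §4 Prop. 4.4 (p. 301)]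
[cite: GrossLMS1991, Prop. 3.7 (2), §3 (pp. 238–239), §4 (4.1)] [cite: Jetchev2008, Prop. 4.4 (p. 821)]
[cite: Nekovar2007, Prop. 4.13 (ii)] -/
theorem exists_data_h47Base_of_frobeniusCongruence_of_irr (h : GrossLMS1991.prop37_2_frobeniusCongruence)
    (W : WeierstrassCurve ℚ) [W.IsElliptic] [W.IsGloballyMinimal] [NeZero (W.conductorNorm ℤ)]
    {K : Type} [Field K] [NumberField K] (hK : IsImaginaryQuadratic K)
    (hD : NumberField.discr K < -4) (hH : SatisfiesHeegnerHypothesis (W.conductorNorm ℤ) K)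
    {p : ℕ} [Fact p.Prime] (hp2 : p ≠ 2) (hp3 : p ≠ 3) (hHp : SatisfiesHeegnerHypothesis p K)
    (hirr : W.HasIrreducibleModPGaloisRep p)
    (Dt : ModularParametrizationData W (W.conductorNorm ℤ)) (β : ℤ) (ι : K →+* ℂ) {k : ℕ} (hk : 1 ≤ k)
    {n : ℕ} (hn : Squarefree n ∧ ∀ q ∈ n.primeFactors,
      Zhang2014.IsKolyvaginPrime (W.conductorNorm ℤ) W K p q ∧ k ≤ Zhang2014.kolyvaginIndex W p q)
    (d : KolyvaginHeegnerData Dt β ι n) :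
    ∃ D : ∀ s : {m : ℕ // Squarefree m ∧ ∀ q ∈ m.primeFactors,
        Zhang2014.IsKolyvaginPrime (W.conductorNorm ℤ) W K p q ∧ k ≤ Zhang2014.kolyvaginIndex W p q},
        KolyvaginHeegnerData Dt β ι s.1, D ⟨n, hn⟩ = d ∧
      ∀ (s s' : {m : ℕ // Squarefree m ∧ ∀ q ∈ m.primeFactors,
        Zhang2014.IsKolyvaginPrime (W.conductorNorm ℤ) W K p q ∧ k ≤ Zhang2014.kolyvaginIndex W p q})
        (ℓ : ℕ), ℓ.Prime → ¬ ℓ ∣ s.1 → s'.1 = s.1 * ℓ → (∀ q ∈ s.1.primeFactors, q < ℓ) → n ∣ s.1 →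
      ∀ v : HeightOneSpectrum (𝓞 K), (ℓ : 𝓞 K) ∈ v.asIdeal →
      addOrderOf (galoisCohomology.localization ((W.baseChange K).torsionGaloisModule ((p ^ k : ℕ) : ℤ))
          (Sum.inr v) 1 ((D s').kolyvaginClass (Fact.out : p.Prime) k)) =
        addOrderOf (galoisCohomology.localization ((W.baseChange K).torsionGaloisModule ((p ^ k : ℕ) : ℤ))
          (Sum.inr v) 1 ((D s).kolyvaginClass (Fact.out : p.Prime) k)) := by
  haveI : ∀ j : ℕ, NumberField (ringClassField K ι j) := numberField_ringClassField K hK ι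
  have hD3 : NumberField.discr K ≠ -3 := by omega
  have hD4 : NumberField.discr K ≠ -4 := by omega
  -- the based family of compatible data (Gross's one system of choices), exactly as in tam3's construction
  obtain ⟨D, hDn, hR⟩ := Walk.exists_basedFamily_of_primeStep
    (data := fun m ↦ KolyvaginHeegnerData Dt β ι m)
    (fun m ↦ Squarefree m ∧ ∀ q ∈ m.primeFactors,
      Zhang2014.IsKolyvaginPrime (W.conductorNorm ℤ) W K p q ∧ k ≤ Zhang2014.kolyvaginIndex W p q)
    (R := fun {a b} (dc : KolyvaginHeegnerData Dt β ι a) (d' : KolyvaginHeegnerData Dt β ι b) ↦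
      (∀ l' ∈ a.primeFactors, ∀ (x : ringClassField K ι a) (x' : ringClassField K ι b),
        (x : ℂ) = x' → ((d'.σ l' x' : ringClassField K ι b) : ℂ) = (dc.σ l' x : ℂ)) ∧
      (∀ t ∈ dc.S, ∃ t' ∈ d'.S, ∀ (x : ringClassField K ι a) (x' : ringClassField K ι b),
        (x : ℂ) = x' → ((t' x' : ringClassField K ι b) : ℂ) = (t x : ℂ)) ∧
      (∀ t' ∈ d'.S, ∃ t ∈ dc.S, ∀ (x : ringClassField K ι a) (x' : ringClassField K ι b),
        (x : ℂ) = x' → ((t' x' : ringClassField K ι b) : ℂ) = (t x : ℂ)) ∧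
      (∀ (x : ringClassField K ι a) (x' : ringClassField K ι b),
        (x : ℂ) = x' → d'.emb x' = dc.emb x))
    (fun m h ↦ h.1) (fun m m' h hm' ↦ ⟨h.1.squarefree_of_dvd hm', fun q hq ↦
      h.2 q (Nat.primeFactors_mono hm' h.1.ne_zero hq)⟩)
    (fun m h ↦ BirchSwinnertonDyer.Theorems.nonempty_kolyvaginHeegnerData_of_grossCM
      (phi_heegnerPointOfConductor_mem_range_map_ringClassField_holds _ W K)
      exists_generator_ringClassGalOver_holds hK hH Dt β ι d.dvd_sq_sub h.1
      (fun q hq ↦ (h.2 q hq).1.2.2.2.2.1))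
    (fun c ℓ dc hA hℓ ↦ by
      have hc0 : c * ℓ ≠ 0 := hA.1.ne_zero
      obtain ⟨hcop, hc, -⟩ := Nat.squarefree_mul_iff.mp hA.1
      have hcK : ∀ q ∈ c.primeFactors, Zhang2014.IsKolyvaginPrime (W.conductorNorm ℤ) W K p q :=
        fun q hq ↦ (hA.2 q (Nat.primeFactors_mono (dvd_mul_right c ℓ) hc0 hq)).1
      have hKol : Zhang2014.IsKolyvaginPrime (W.conductorNorm ℤ) W K p ℓ :=
        (hA.2 ℓ (Nat.mem_primeFactors.mpr ⟨hℓ, dvd_mul_left ℓ c, hc0⟩)).1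
      have hℓc : ℓ ∉ c.primeFactors := fun h ↦
        (Nat.Prime.coprime_iff_not_dvd hℓ).mp hcop.symm (Nat.dvd_of_mem_primeFactors h)
      obtain ⟨dℓ, hdℓ⟩ := exists_compatible_data_of_grossCM
        (phi_heegnerPointOfConductor_mem_range_map_ringClassField_holds _ W K) hK hD hH p Dt β ι hc
        hcK dc
      exact ⟨dℓ ℓ hKol hℓc, hdℓ ℓ hKol hℓc⟩)
    hn d
  refine ⟨D, hDn, ?_⟩
  intro s s' ℓ hℓ hℓs hs' hlt hns v hv
  obtain ⟨hσ, hS1, hS2, hemb⟩ := hR s s' ℓ hℓ hℓs hs' hlt hns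
  -- transport the datum at `s'` along `s'.1 = s.1 * ℓ`
  obtain ⟨m', hm'⟩ := s'
  change m' = s.1 * ℓ at hs'
  subst hs'
  -- (γ) for the pair, BY NAME (the prime factors of `s·ℓ` are Zhang–Kolyvagin for `p ≠ 3`, so `ℓ ≠ 2`)
  haveI : Fact ℓ.Prime := ⟨hℓ⟩
  exact addOrderOf_localization_kolyvaginClass_mul_eq_of_congruence_of_irr hK hD3 hD4 hH hp2 hHp hirr Dt β ι k hk
    s.1 ℓ hm'.1 hℓ hℓs hm'.2 (D s) (D ⟨s.1 * ℓ, hm'⟩) hσ hS1 hS2 hemb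
    (fun hΔ φ₀ hφ₀ hle γ _ ↦ congruence_pair_of_frobeniusCongruence h hK hD3 hD4 hH hp3 hm'.1 hℓ
      (fun q hq ↦ (hm'.2 q hq).1) (D ⟨s.1 * ℓ, hm'⟩) (D s) hΔ φ₀ hφ₀ hle γ) v hv

end Summit.BirchSwinnertonDyer.BirchSwinnertonDyer.Theorems.Prop44

end
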